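import Summits.CriticalPhenomena.PercolationContinuityZ3.Theorems.PercNearOneGluingNoHeavyLowerTailSunflowerTriangleEdgeReduction
import Summits.CriticalPhenomena.PercolationContinuityZ3.Theorems.PercNearOneGluingNoHeavyLowerTailSunflowerPendantReduction
import Mathlib.Data.Finset.Option
import HarnessLib

/-!
# `NoHeavyLowerTail` (crux stmt-CriticalPhenomena-4575), abstract sunflower cubic: the class of GRAPH-MARK (rank-2) sunflowers —
# labels generated by a 3-edge-colouring and colour marks — with its closure under deletion / contraction and the local label calculus

Support file (seat `prim-ineq-gen-2` gen 26; `--supports stmt-CriticalPhenomena-4575`).  No `sorry`; nothing is asserted about the crux.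
Memo: run/shared/lean/prim/prim-ineq-gen-2/TWO-POINT-GEN25.md §8–§9 and GRAPHMARK-LEAN-GEN26.md.  This is the vocabulary of the structured-window
induction for ★ = `PartitionLemmaH` on graph sunflowers; the driver (`…SunflowerGraphMarkMaxDegTwo`) proves `0 ≤ ZH` for every properly
3-edge-coloured graph of maximum degree `≤ 2` with arbitrary colour marks from the ten landed local certificates.

OBJECTS.  A colouring `c : α → α → Option (Fin 3)` of the pairs of a finite ground set (`none` = no edge) and marks `T : α → Finset (Fin 3)`.
The colour set generated inside `X ⊆ α` is `cols c T X = ⋃_{x ∈ X} T x ∪ {c x y : x, y ∈ X}`; its `M₃`-label is `theta` (`∅ ↦ ⊥`, `{i} ↦` petal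
`i+1`, two or more colours `↦ ⊤`).  A sunflower `F` is GRAPH-MARK on the sub-cube `2^W` (`F.IsGraphMarkOn c T W`) if `F.lab X = theta (cols c T X)`
for all `X ⊆ W`; `graphMarkSunflower c T` (a `θ`-pullback `ofUpsets`) is graph-mark on every `W` (`graphMarkSunflower_isGraphMarkOn`).
CLOSURE.  Deleting points (`IsGraphMarkOn.mono`) and contracting an UNMARKED point `v` (`IsGraphMarkOn.con`: the upper section `F.con v` is
graph-mark for the same colouring and the marks `addMarks c T v x = T x ∪ {c v x}`) stay in the class; recolouring by an injective
`g : Fin 3 → Fin 3` permutes the labels by `permLab g` and leaves `ZP` unchanged (`IsGraphMarkOn.ZP_eq_of_recolour`, `s6H_permLab`).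
LABEL CALCULUS.  `IsGraphMarkOn.lab_insert`: `lab (X + v) = lab X ∨ theta (nb c v X)` for an unmarked `v`, `nb c v X` = colours of the edges from `v`
into `X`; `nb_eq_ite` / `nb_eq_empty` evaluate it when `v` has at most one neighbour in `X`; the finite identities `theta_union`, `joinM_petalOf`,
`joinM_jn_petalOf_of_ne`, … (`decide`) turn these into the `if … then jn (lab X) k else lab X` hypotheses of the window certificates.
-/

namespace Summit.CriticalPhenomena.PercolationContinuityZ3.Theorems.SunflowerPartition

open Finset

/-! ## Colour sets and their `M₃` labels -/

/-- The `M₃`-label (on `Fin 5`) of a set of colours: `∅ ↦ 0`, `{i} ↦ i+1`, at least two colours `↦ 4`. [this work] -/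
def theta (S : Finset (Fin 3)) : Fin 5 :=
  if (0 : Fin 3) ∈ S then (if (1 : Fin 3) ∈ S ∨ (2 : Fin 3) ∈ S then 4 else 1)
  else if (1 : Fin 3) ∈ S then (if (2 : Fin 3) ∈ S then 4 else 2)
  else if (2 : Fin 3) ∈ S then 3 else 0

/-- The petal label `i+1` of the colour `i`. [this work] -/
def petalOf (i : Fin 3) : Fin 5 := ⟨i.val + 1, by omega⟩

/-- The map of `M₃` induced by a map of the colours (`⊥`, `⊤` fixed). [this work] -/
def permLab (g : Fin 3 → Fin 3) (x : Fin 5) : Fin 5 :=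
  if x = 1 then petalOf (g 0) else if x = 2 then petalOf (g 1) else if x = 3 then petalOf (g 2) else x

/-- `petalOf 0 = 1`. [this work] -/
@[simp] theorem petalOf_zero : petalOf 0 = 1 := by decide
/-- `petalOf 1 = 2`. [this work] -/
@[simp] theorem petalOf_one : petalOf 1 = 2 := by decide
/-- `petalOf 2 = 3`. [this work] -/
@[simp] theorem petalOf_two : petalOf 2 = 3 := by decide
/-- A petal label is not `⊥`. [this work] -/
theorem petalOf_ne_zero : ∀ i : Fin 3, petalOf i ≠ 0 := by decide

/-- `theta ∅ = ⊥`. [this work] -/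
@[simp] theorem theta_empty : theta ∅ = 0 := by decide
/-- `theta {i}` is the petal `i+1`. [this work] -/
@[simp] theorem theta_singleton : ∀ i : Fin 3, theta {i} = petalOf i := by decide
/-- `theta` of a union is the `M₃`-join. [this work] -/
theorem theta_union : ∀ A B : Finset (Fin 3), theta (A ∪ B) = joinM (theta A) (theta B) := by decide
/-- A nonempty colour set has a nonzero label. [this work] -/
theorem theta_ne_zero : ∀ A : Finset (Fin 3), A ≠ ∅ → theta A ≠ 0 := by decide
/-- Two distinct colours give `⊤`. [this work] -/
theorem theta_eq_four_of_mem : ∀ (A : Finset (Fin 3)) (i j : Fin 3), i ≠ j → i ∈ A → j ∈ A → theta A = 4 := by decide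
/-- `theta ({i} ∪ {j}) = ⊤` for `i ≠ j`. [this work] -/
theorem theta_singleton_union_singleton : ∀ i j : Fin 3, i ≠ j → theta ({i} ∪ {j}) = 4 := by decide
/-- Recolouring a colour set acts on its label by `permLab`. [this work] -/
theorem theta_image_permLab : ∀ g : Fin 3 → Fin 3, Function.Injective g → ∀ A : Finset (Fin 3),
    theta (A.image g) = permLab g (theta A) := by decide
/-- `s6H` is invariant under colour permutations. [this work] -/
theorem s6H_permLab : ∀ g : Fin 3 → Fin 3, Function.Injective g → ∀ x y z : Fin 5,
    s6H (permLab g x) (permLab g y) (permLab g z) = s6H x y z := by decide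
/-- Two distinct colours can be renamed `0` and `1`. [this work] -/
theorem exists_recolouring : ∀ a b : Fin 3, a ≠ b → ∃ g : Fin 3 → Fin 3, Function.Injective g ∧ g a = 0 ∧ g b = 1 := by decide

/-- `x ∨ ⊥ = x`. [this work] -/
@[simp] theorem joinM_zero_right : ∀ x : Fin 5, joinM x 0 = x := by decide
/-- `x ∨ ⊤ = ⊤`. [this work] -/
@[simp] theorem joinM_four_right : ∀ x : Fin 5, joinM x 4 = 4 := by decide
/-- Join with a petal is `jn`. [this work] -/
@[simp] theorem joinM_petalOf : ∀ (x : Fin 5) (i : Fin 3), joinM x (petalOf i) = jn x (petalOf i) := by decide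
/-- Joining two distinct petals gives `⊤`. [this work] -/
theorem jn_jn_petalOf_of_ne : ∀ (x : Fin 5) (i j : Fin 3), i ≠ j → jn (jn x (petalOf i)) (petalOf j) = 4 := by decide
/-- Joining the same petal twice. [this work] -/
@[simp] theorem jn_jn_petalOf_same : ∀ (x : Fin 5) (i : Fin 3), jn (jn x (petalOf i)) (petalOf i) = jn x (petalOf i) := by decide
/-- `⊤ ∨ c = ⊤`. [this work] -/
@[simp] theorem jn_four_left : ∀ c : Fin 5, jn 4 c = 4 := by decide

/-! ## Colour sets generated by marks and edges -/

variable {α : Type*}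

/-- The colours generated inside `X`: marks of its points and colours of the edges it spans. [this work] -/
def cols (c : α → α → Option (Fin 3)) (T : α → Finset (Fin 3)) (X : Finset α) : Finset (Fin 3) :=
  X.biUnion T ∪ X.biUnion fun x => X.biUnion fun y => (c x y).toFinset

/-- The colours of the edges from `v` into `X`. [this work] -/
def nb (c : α → α → Option (Fin 3)) (v : α) (X : Finset α) : Finset (Fin 3) :=
  X.biUnion fun y => (c v y).toFinset

/-- The marks after contracting `v`: every neighbour of `v` receives the colour of its edge to `v`. [this work] -/
def addMarks (c : α → α → Option (Fin 3)) (T : α → Finset (Fin 3)) (v : α) : α → Finset (Fin 3) :=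
  fun x => T x ∪ (c v x).toFinset

section ColsCalculus

variable {c : α → α → Option (Fin 3)} {T : α → Finset (Fin 3)}

/-- Membership in `Option.toFinset`. [folklore] -/
theorem mem_toFinset_iff {i : Fin 3} {o : Option (Fin 3)} : i ∈ o.toFinset ↔ o = some i := by
  rw [Option.mem_toFinset, Option.mem_def]

/-- `none ≠ some`. [folklore] -/
theorem none_ne_some' (i : Fin 3) : (none : Option (Fin 3)) ≠ some i := fun h => Option.some_ne_none i h.symm

/-- Membership in `cols`. [this work] -/
theorem mem_cols {X : Finset α} {i : Fin 3} :
    i ∈ cols c T X ↔ (∃ x ∈ X, i ∈ T x) ∨ ∃ x ∈ X, ∃ y ∈ X, c x y = some i := by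
  unfold cols
  simp only [mem_union, mem_biUnion, mem_toFinset_iff]

/-- Membership in `nb`. [this work] -/
theorem mem_nb {v : α} {X : Finset α} {i : Fin 3} : i ∈ nb c v X ↔ ∃ y ∈ X, c v y = some i := by
  unfold nb
  simp only [mem_biUnion, mem_toFinset_iff]

/-- `cols` is monotone. [this work] -/
theorem cols_mono {X Y : Finset α} (h : X ⊆ Y) : cols c T X ⊆ cols c T Y := by
  intro i hi
  rw [mem_cols] at hi ⊢
  rcases hi with ⟨x, hx, hxi⟩ | ⟨x, hx, y, hy, hxy⟩
  · exact Or.inl ⟨x, h hx, hxi⟩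
  · exact Or.inr ⟨x, h hx, y, h hy, hxy⟩

/-- An edge inside `Y` contributes its colour. [this work] -/
theorem mem_cols_of_edge {Y : Finset α} {x y : α} {i : Fin 3} (hx : x ∈ Y) (hy : y ∈ Y) (h : c x y = some i) : i ∈ cols c T Y :=
  mem_cols.2 (Or.inr ⟨x, hx, y, hy, h⟩)

/-- The colours generated by a single point are its marks. [this work] -/
theorem cols_singleton (hirr : ∀ x, c x x = none) (v : α) : cols c T {v} = T v := by
  ext i
  rw [mem_cols]
  constructor
  · rintro (⟨x, hx, hxi⟩ | ⟨x, hx, y, hy, hxy⟩)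
    · rw [mem_singleton] at hx; rwa [hx] at hxi
    · rw [mem_singleton] at hx hy
      rw [hx, hy, hirr] at hxy
      exact (none_ne_some' i hxy).elim
  · intro hi
    exact Or.inl ⟨v, mem_singleton_self v, hi⟩

/-- The marks of a contracted point reproduce the colours it generated. [this work] -/
theorem cols_addMarks (v : α) (X : Finset α) : cols c (addMarks c T v) X = cols c T X ∪ nb c v X := by
  ext i
  rw [mem_union, mem_cols, mem_cols, mem_nb]
  constructor
  · rintro (⟨x, hx, hxi⟩ | h)
    · rcases mem_union.1 hxi with hxi | hxi
      · exact Or.inl (Or.inl ⟨x, hx, hxi⟩)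
      · exact Or.inr ⟨x, hx, mem_toFinset_iff.1 hxi⟩
    · exact Or.inl (Or.inr h)
  · rintro ((⟨x, hx, hxi⟩ | h) | ⟨y, hy, hvy⟩)
    · exact Or.inl ⟨x, hx, mem_union.2 (Or.inl hxi)⟩
    · exact Or.inr h
    · exact Or.inl ⟨y, hy, mem_union.2 (Or.inr (mem_toFinset_iff.2 hvy))⟩

/-- No edges into `X`: no colours. [this work] -/
theorem nb_eq_empty {v : α} {X : Finset α} (h : ∀ y ∈ X, c v y = none) : nb c v X = ∅ := by
  ext i
  rw [mem_nb]
  simp only [notMem_empty, iff_false, not_exists, not_and]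
  intro y hy hvy
  rw [h y hy] at hvy
  exact none_ne_some' i hvy

/-- Recolouring the data recolours the generated colour set. [this work] -/
theorem cols_recolour [DecidableEq α] (g : Fin 3 → Fin 3) (X : Finset α) :
    cols (fun x y => (c x y).map g) (fun x => (T x).image g) X = (cols c T X).image g := by
  ext i
  simp only [mem_cols, mem_image, Option.map_eq_some_iff]
  constructor
  · rintro (⟨x, hx, j, hj, hji⟩ | ⟨x, hx, y, hy, j, hj, hji⟩)
    · exact ⟨j, Or.inl ⟨x, hx, hj⟩, hji⟩
    · exact ⟨j, Or.inr ⟨x, hx, y, hy, hj⟩, hji⟩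
  · rintro ⟨j, ⟨x, hx, hj⟩ | ⟨x, hx, y, hy, hj⟩, hji⟩
    · exact Or.inl ⟨x, hx, j, hj, hji⟩
    · exact Or.inr ⟨x, hx, y, hy, j, hj, hji⟩

variable [DecidableEq α]

/-- Adding a point adds its marks and the colours of its edges into the set. [this work] -/
theorem cols_insert (hsym : ∀ x y, c x y = c y x) (hirr : ∀ x, c x x = none) (v : α) (X : Finset α) :
    cols c T (insert v X) = cols c T X ∪ (T v ∪ nb c v X) := by
  ext i
  rw [mem_union, mem_union, mem_cols, mem_cols, mem_nb]
  constructor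
  · rintro (⟨x, hx, hxi⟩ | ⟨x, hx, y, hy, hxy⟩)
    · rcases mem_insert.1 hx with hx | hx
      · rw [hx] at hxi; exact Or.inr (Or.inl hxi)
      · exact Or.inl (Or.inl ⟨x, hx, hxi⟩)
    · rcases mem_insert.1 hx with hx | hx <;> rcases mem_insert.1 hy with hy | hy
      · rw [hx, hy, hirr] at hxy; exact (none_ne_some' i hxy).elim
      · rw [hx] at hxy; exact Or.inr (Or.inr ⟨y, hy, hxy⟩)
      · rw [hy, hsym] at hxy; exact Or.inr (Or.inr ⟨x, hx, hxy⟩)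
      · exact Or.inl (Or.inr ⟨x, hx, y, hy, hxy⟩)
  · rintro ((⟨x, hx, hxi⟩ | ⟨x, hx, y, hy, hxy⟩) | (h | ⟨y, hy, hvy⟩))
    · exact Or.inl ⟨x, mem_insert_of_mem hx, hxi⟩
    · exact Or.inr ⟨x, mem_insert_of_mem hx, y, mem_insert_of_mem hy, hxy⟩
    · exact Or.inl ⟨v, mem_insert_self v X, h⟩
    · exact Or.inr ⟨v, mem_insert_self v X, y, mem_insert_of_mem hy, hvy⟩

/-- Exactly one possible neighbour `u` in `X`, of colour `k`. [this work] -/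
theorem nb_eq_ite {v u : α} {k : Fin 3} {X : Finset α} (hu : c v u = some k) (h : ∀ y ∈ X, y ≠ u → c v y = none) :
    nb c v X = if u ∈ X then {k} else ∅ := by
  ext i
  rw [mem_nb]
  split_ifs with huX
  · rw [mem_singleton]
    constructor
    · rintro ⟨y, hy, hvy⟩
      by_cases hyu : y = u
      · rw [hyu, hu] at hvy; exact (Option.some_injective _ hvy).symm
      · rw [h y hy hyu] at hvy; exact (none_ne_some' i hvy).elim
    · intro hik; exact ⟨u, huX, by rw [hu, hik]⟩
  · simp only [notMem_empty, iff_false, not_exists, not_and]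
    intro y hy hvy
    by_cases hyu : y = u
    · exact huX (hyu ▸ hy)
    · rw [h y hy hyu] at hvy; exact none_ne_some' i hvy

/-- `nb` of an enlarged set. [this work] -/
theorem nb_insert (v y : α) (X : Finset α) : nb c v (insert y X) = (c v y).toFinset ∪ nb c v X := by
  unfold nb
  rw [biUnion_insert]

end ColsCalculus

/-! ## The class of graph-mark sunflowers on a sub-cube -/

namespace Sunflower

variable [DecidableEq α] (F : Sunflower α)

/-- `F` is a GRAPH-MARK SUNFLOWER on `2^W` for the colouring `c` and the marks `T`: `lab X = theta (cols c T X)` for every `X ⊆ W`. [this work] -/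
def IsGraphMarkOn (c : α → α → Option (Fin 3)) (T : α → Finset (Fin 3)) (W : Finset α) : Prop :=
  ∀ X ⊆ W, F.lab X = theta (cols c T X)

variable {F} {c : α → α → Option (Fin 3)} {T : α → Finset (Fin 3)} {W : Finset α}

/-- Closure under deleting points (restriction to a smaller sub-cube). [this work] -/
theorem IsGraphMarkOn.mono (h : F.IsGraphMarkOn c T W) {W' : Finset α} (hW' : W' ⊆ W) : F.IsGraphMarkOn c T W' :=
  fun X hX => h X (hX.trans hW')

/-- Label of a singleton: its marks. [this work] -/
theorem IsGraphMarkOn.lab_singleton (h : F.IsGraphMarkOn c T W) (hirr : ∀ x, c x x = none) {v : α} (hv : v ∈ W) :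
    F.lab {v} = theta (T v) := by
  rw [h {v} (singleton_subset_iff.2 hv), cols_singleton hirr]

/-- **Local label calculus**: adding an unmarked point `v ∈ W` to `X ⊆ W` joins `lab X` with the label of the colours of the edges from `v`
into `X`. [this work] -/
theorem IsGraphMarkOn.lab_insert (h : F.IsGraphMarkOn c T W) (hsym : ∀ x y, c x y = c y x) (hirr : ∀ x, c x x = none)
    {v : α} (hv : v ∈ W) (hTv : T v = ∅) {X : Finset α} (hX : X ⊆ W) :
    F.lab (insert v X) = joinM (F.lab X) (theta (nb c v X)) := by
  rw [h _ (insert_subset hv hX), cols_insert hsym hirr, hTv, empty_union, theta_union, h X hX]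

/-- **Recolouring invariance**: two sunflowers that are graph-mark on `2^W` for data differing by an injective recolouring have the same
partition functional on `W`. [this work] -/
theorem IsGraphMarkOn.ZP_eq_of_recolour {G : Sunflower α} {g : Fin 3 → Fin 3} (hg : Function.Injective g)
    (hF : F.IsGraphMarkOn c T W) (hG : G.IsGraphMarkOn (fun x y => (c x y).map g) (fun x => (T x).image g) W) :
    F.ZP W ∅ ∅ ∅ = G.ZP W ∅ ∅ ∅ := by
  rw [F.ZP_empty_eq_nested, G.ZP_empty_eq_nested]
  have e : ∀ Y ⊆ W, G.lab Y = permLab g (F.lab Y) := fun Y hY => by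
    rw [hG Y hY, cols_recolour, theta_image_permLab g hg, hF Y hY]
  refine nested_congr W _ _ fun X hX S hS => ?_
  rw [e X hX, e S (hS.trans sdiff_subset), e _ (sdiff_subset.trans sdiff_subset), s6H_permLab g hg]

variable [Fintype α]

/-- **Closure under contracting an unmarked point**: the upper section `F.con v` is graph-mark on every `W' ⊆ W` for the marks `addMarks c T v`.
[this work] -/
theorem IsGraphMarkOn.con (h : F.IsGraphMarkOn c T W) (hsym : ∀ x y, c x y = c y x) (hirr : ∀ x, c x x = none)
    {v : α} (hv : v ∈ W) (hTv : T v = ∅) {W' : Finset α} (hW' : W' ⊆ W) :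
    (F.con v).IsGraphMarkOn c (addMarks c T v) W' := by
  intro X hX
  rw [F.lab_con, h _ (insert_subset hv (hX.trans hW')), cols_insert hsym hirr, hTv, empty_union, cols_addMarks]

end Sunflower

/-! ## The graph-mark sunflower of a colouring and marks -/

section Construction

variable [DecidableEq α]

/-- Labels of a `θ`-pullback: `theta` of the set of indices `i` with `S ∈ U i`. [this work] -/
theorem lab_ofUpsets_eq_theta (U : Fin 3 → Finset (Finset α)) (hU : ∀ i, IsUpperSet (U i : Set (Finset α))) (S : Finset α) :
    (ofUpsets U hU).lab S = theta (univ.filter fun i => S ∈ U i) := by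
  unfold Sunflower.lab Sunflower.A theta
  simp only [ofUpsets, mem_inter, mem_union, mem_twoOf, mem_filter, mem_univ, true_and]
  by_cases h0 : S ∈ U 0 <;> by_cases h1 : S ∈ U 1 <;> by_cases h2 : S ∈ U 2 <;> simp [h0, h1, h2]

variable [Fintype α]

/-- **The graph-mark sunflower** of a colouring `c` and marks `T`: the `θ`-pullback of the three up-sets "colour `i` is generated inside `X`".
[this work] -/
def graphMarkSunflower (c : α → α → Option (Fin 3)) (T : α → Finset (Fin 3)) : Sunflower α :=
  ofUpsets (fun i => univ.filter fun X => i ∈ cols c T X) fun i => by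
    intro X Y hXY hX
    simp only [coe_filter, mem_univ, true_and, Set.mem_setOf_eq] at hX ⊢
    exact cols_mono hXY hX

/-- The graph-mark sunflower is graph-mark on every sub-cube. [this work] -/
theorem graphMarkSunflower_isGraphMarkOn (c : α → α → Option (Fin 3)) (T : α → Finset (Fin 3)) (W : Finset α) :
    (graphMarkSunflower c T).IsGraphMarkOn c T W := by
  intro X _
  rw [graphMarkSunflower, lab_ofUpsets_eq_theta]
  congr 1
  ext i
  simp only [mem_filter, mem_univ, true_and]

end Construction

end Summit.CriticalPhenomena.PercolationContinuityZ3.Theorems.SunflowerPartition
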